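import Summits.SmoothPoincare4.SmoothPoincare4.Theses.ZeroSurgeryExotic
import Summits.SmoothPoincare4.SmoothPoincare4.Theorems.ZeroSurgeryExoticAssembly2Record
import Literature.Topology.FourManifolds.HomotopyBallSliceProofs
import Literature.Uncategorized.Crux
import Literature.Topology.FourManifolds.Rasmussen
import Literature.Topology.FourManifolds.RasmussenProofs
import Literature.Topology.FourManifolds.RasmussenConcordanceProofs
import Literature.Topology.FourManifolds.DehnSurgeryProofs
import Literature.Topology.FourManifolds.KnotsProofs
import Literature.Barriers.SmoothPoincare4.GluckTwistsDissolve
import HarnessLib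

/-!
# `ZseCruxRasmussen` — negative knowledge I: shape of the crux (load-bearing conjuncts, dead strengthenings, position)

Refuter support lemmas for crux `stmt-SmoothPoincare4-0366` (route ZeroSurgeryExotic, crux #2; the
statement is the tree's registered open existential `Literature.Uncategorized.Crux`, ledger signature
verbatim: knots `K, K'` with a common `0`-surgery `Y`, `K` smoothly slice, `K'.HasRasmussenInvariant s`,
`s ≠ 0`), extracted from the standing disprover's work file
`Summits/SmoothPoincare4/SmoothPoincare4/Cruxes/ZseCruxRasmussen/Disproof.lean` §1–§4 (resubmission of the
content of p72945/p73488, both bounced only by a gate restart). No definitions; no route item is concluded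
positively. (The sibling crux's `Theorems/ZseSVanishesOnPairs/Negative/Position.lean` proves the
`SVanishesOnPairs`-side forms of §3; here the `¬ Crux`-side forms are given directly, in three lines each.)

* §1 NO JUNK ESCAPE — every conjunct is load-bearing: the `s`-witness conjunct is honestly inhabited
  (`s(T(2,3)) = 2`, an unconditional tree theorem), and the crux with ANY ONE conjunct deleted is a THEOREM
  (`crux_without_slice/_nonzero/_commonSurgery/_surgeryLeft/_surgeryRight`), so the statement is neither
  junk-true nor junk-false: the whole content is the conjunction.
* §2 DEAD STRENGTHENINGS (mod Rasmussen's Theorem 1, the tree's named fact `eq_zero_of_isSmoothlySlice`):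
  `K = K'`, `K'` concordant to `K`, `K'` slice are each impossible — witnesses are NON-CONCORDANT pairs
  with a common `0`-surgery.
* §3 POSITION: `¬ Crux` follows from MMSW Question 9.11 (tree: `sVanishesOnPairs_of_mmsw2023Question911Knot`),
  from "the `0`-surgery type determines sliceness" (body of the route's kill switch `Assembly2`) mod
  Rasmussen, and from `SmoothPoincare4` mod Rasmussen (through the PROVED Manolescu–Piccirillo Lemma 3.3,
  `Literature.Uncategorized.isHomotopyBallSlice_of_zeroSurgeryPair`, and the PROVED FGMW lemma
  `Knot.exists_exotic_of_isHomotopyBallSlice_not_isSmoothlySlice_holds`).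
* §4 BARRIER SUB-FAMILY: mod MMSW Cor. 1.13 (named fact `rasmussen_eq_zero_of_isSliceDiscIn_gluckTwist`) the
  partner `K'` of a witness bounds no disc in a punctured Gluck twist.
References: Rasmussen 2010 Thm. 1, Thm. 4 [Rasmussen2010]; Manolescu–Piccirillo 2023 §1, Lemma 3.3
[ManolescuPiccirillo2023]; Manolescu–Marengon–Sarkar–Willis 2023 Cor. 1.13, Question 9.11
[ManolescuMarengonSarkarWillis2023]; Fox–Milnor 1966 [FoxMilnor1966].
-/

noncomputable section

set_option linter.dupNamespace false

namespace Summit.SmoothPoincare4.SmoothPoincare4.Theorems.ZseCruxRasmussen.Negative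

open scoped Manifold ContDiff
open Literature.Topology.FourManifolds Literature.Barriers.SmoothPoincare4 Literature.Uncategorized

/-! ## §1 Every conjunct is inhabited; every one-conjunct deletion is a theorem -/

/-- The `s`-witness conjunct is honestly satisfiable: `s(T(2,3)) = 2 ≠ 0`, an unconditional theorem of
the tree (Lee complex of the standard diagram). [cite: Rasmussen2010, Thm. 4] -/
theorem sWitness_inhabited : ∃ (K : Knot) (s : ℤ), K.HasRasmussenInvariant s ∧ s ≠ 0 :=
  ⟨torusKnot 2 3 le_rfl (by norm_num) (by norm_num), ((2 : ℤ) - 1) * ((3 : ℤ) - 1),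
    hasRasmussenInvariant_torusKnot_holds 2 3 le_rfl (by norm_num) (by norm_num), by norm_num⟩

/-- **`K.IsSmoothlySlice` is load-bearing**: the crux with it deleted is a theorem
(`K = K' = T(2,3)`, `Y = S³₀(T(2,3))`, `s = 2`). [cite: Rasmussen2010, Thm. 4] -/
theorem crux_without_slice :
    ∃ (K K' : Knot) (Y : Type) (_ : TopologicalSpace Y) (_ : ChartedSpace (EuclideanSpace ℝ (Fin 3)) Y)
      (s : ℤ), IsIntegralSurgery (𝓡 3) Y K 0 ∧ IsIntegralSurgery (𝓡 3) Y K' 0 ∧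
        K'.HasRasmussenInvariant s ∧ s ≠ 0 := by
  obtain ⟨Y, _, _, _, _, _, _, hY⟩ :=
    exists_isIntegralSurgery_holds (torusKnot 2 3 le_rfl (by norm_num) (by norm_num)) 0
  exact ⟨_, _, Y, _, _, ((2 : ℤ) - 1) * ((3 : ℤ) - 1), hY, hY,
    hasRasmussenInvariant_torusKnot_holds 2 3 le_rfl (by norm_num) (by norm_num), by norm_num⟩

/-- **`s ≠ 0` is load-bearing**: the crux with it deleted is a theorem (`K = K' =` unknot, `s = 0`).
[cite: Rasmussen2010, §3] -/
theorem crux_without_nonzero :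
    ∃ (K K' : Knot) (Y : Type) (_ : TopologicalSpace Y) (_ : ChartedSpace (EuclideanSpace ℝ (Fin 3)) Y)
      (s : ℤ), IsIntegralSurgery (𝓡 3) Y K 0 ∧ IsIntegralSurgery (𝓡 3) Y K' 0 ∧ K.IsSmoothlySlice ∧
        K'.HasRasmussenInvariant s := by
  obtain ⟨Y, _, _, _, _, _, _, hY⟩ := exists_isIntegralSurgery_holds unknot 0
  exact ⟨unknot, unknot, Y, _, _, 0, hY, hY, isSmoothlySlice_unknot, hasRasmussenInvariant_unknot_holds⟩

/-- **The COMMON `0`-surgery is load-bearing**: with two unrelated surgered manifolds `Y`, `Y'` the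
crux is a theorem (`K =` unknot, `K' = T(2,3)`). [cite: Rasmussen2010, Thm. 4] -/
theorem crux_without_commonSurgery :
    ∃ (K K' : Knot) (Y : Type) (_ : TopologicalSpace Y) (_ : ChartedSpace (EuclideanSpace ℝ (Fin 3)) Y)
      (Y' : Type) (_ : TopologicalSpace Y') (_ : ChartedSpace (EuclideanSpace ℝ (Fin 3)) Y') (s : ℤ),
      IsIntegralSurgery (𝓡 3) Y K 0 ∧ IsIntegralSurgery (𝓡 3) Y' K' 0 ∧ K.IsSmoothlySlice ∧
        K'.HasRasmussenInvariant s ∧ s ≠ 0 := by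
  obtain ⟨Y, _, _, _, _, _, _, hY⟩ := exists_isIntegralSurgery_holds unknot 0
  obtain ⟨Y', _, _, _, _, _, _, hY'⟩ :=
    exists_isIntegralSurgery_holds (torusKnot 2 3 le_rfl (by norm_num) (by norm_num)) 0
  exact ⟨unknot, _, Y, _, _, Y', _, _, ((2 : ℤ) - 1) * ((3 : ℤ) - 1), hY, hY', isSmoothlySlice_unknot,
    hasRasmussenInvariant_torusKnot_holds 2 3 le_rfl (by norm_num) (by norm_num), by norm_num⟩

/-- **"`Y` is `0`-surgery on `K`" is load-bearing**: deleting it, the crux is a theorem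
(`K =` unknot, `K' = T(2,3)`, `Y = S³₀(K')`). [cite: Rasmussen2010, Thm. 4] -/
theorem crux_without_surgeryLeft :
    ∃ (K K' : Knot) (Y : Type) (_ : TopologicalSpace Y) (_ : ChartedSpace (EuclideanSpace ℝ (Fin 3)) Y)
      (s : ℤ), IsIntegralSurgery (𝓡 3) Y K' 0 ∧ K.IsSmoothlySlice ∧ K'.HasRasmussenInvariant s ∧ s ≠ 0 := by
  obtain ⟨Y, _, _, _, _, _, _, hY⟩ :=
    exists_isIntegralSurgery_holds (torusKnot 2 3 le_rfl (by norm_num) (by norm_num)) 0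
  exact ⟨unknot, _, Y, _, _, ((2 : ℤ) - 1) * ((3 : ℤ) - 1), hY, isSmoothlySlice_unknot,
    hasRasmussenInvariant_torusKnot_holds 2 3 le_rfl (by norm_num) (by norm_num), by norm_num⟩

/-- **"`Y` is `0`-surgery on `K'`" is load-bearing**: deleting it, the crux is a theorem
(`K =` unknot, `Y = S³₀(U)`, `K' = T(2,3)`). [cite: Rasmussen2010, Thm. 4] -/
theorem crux_without_surgeryRight :
    ∃ (K K' : Knot) (Y : Type) (_ : TopologicalSpace Y) (_ : ChartedSpace (EuclideanSpace ℝ (Fin 3)) Y)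
      (s : ℤ), IsIntegralSurgery (𝓡 3) Y K 0 ∧ K.IsSmoothlySlice ∧ K'.HasRasmussenInvariant s ∧ s ≠ 0 := by
  obtain ⟨Y, _, _, _, _, _, _, hY⟩ := exists_isIntegralSurgery_holds unknot 0
  exact ⟨unknot, torusKnot 2 3 le_rfl (by norm_num) (by norm_num), Y, _, _,
    ((2 : ℤ) - 1) * ((3 : ℤ) - 1), hY, isSmoothlySlice_unknot,
    hasRasmussenInvariant_torusKnot_holds 2 3 le_rfl (by norm_num) (by norm_num), by norm_num⟩

/-! ## §2 Dead strengthenings (mod Rasmussen's Theorem 1, tree named fact `eq_zero_of_isSmoothlySlice`) -/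

/-- `K = K'` is impossible: a slice knot has `s = 0`. [cite: Rasmussen2010, Thm. 1] -/
theorem crux_false_of_sameKnot (hR : eq_zero_of_isSmoothlySlice) :
    ¬ ∃ (K : Knot) (Y : Type) (_ : TopologicalSpace Y) (_ : ChartedSpace (EuclideanSpace ℝ (Fin 3)) Y)
        (s : ℤ), IsIntegralSurgery (𝓡 3) Y K 0 ∧ K.IsSmoothlySlice ∧ K.HasRasmussenInvariant s ∧ s ≠ 0 := by
  rintro ⟨K, Y, _, _, s, -, hsl, hs, hs0⟩
  exact hs0 (hR hs hsl)

/-- A partner `K'` CONCORDANT to `K` is impossible (concordant to slice ⇒ slice, Fox–Milnor — a theorem of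
the tree, `Knot.IsConcordant.isSmoothlySlice`; then `s(K') = 0`). So witnesses are non-concordant pairs with
a common `0`-surgery. [cite: Rasmussen2010, Thm. 1] [cite: FoxMilnor1966, §1] -/
theorem crux_false_of_concordant (hR : eq_zero_of_isSmoothlySlice) :
    ¬ ∃ (K K' : Knot) (Y : Type) (_ : TopologicalSpace Y) (_ : ChartedSpace (EuclideanSpace ℝ (Fin 3)) Y)
        (s : ℤ), IsIntegralSurgery (𝓡 3) Y K 0 ∧ IsIntegralSurgery (𝓡 3) Y K' 0 ∧ K.IsSmoothlySlice ∧
          K'.HasRasmussenInvariant s ∧ s ≠ 0 ∧ K'.IsConcordant K := by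
  rintro ⟨K, K', Y, _, _, s, -, -, hsl, hs, hs0, hc⟩
  exact hs0 (hR hs (hc.isSmoothlySlice hsl))

/-- A SLICE partner `K'` is impossible. [cite: Rasmussen2010, Thm. 1] -/
theorem crux_false_of_slicePartner (hR : eq_zero_of_isSmoothlySlice) :
    ¬ ∃ (K K' : Knot) (Y : Type) (_ : TopologicalSpace Y) (_ : ChartedSpace (EuclideanSpace ℝ (Fin 3)) Y)
        (s : ℤ), IsIntegralSurgery (𝓡 3) Y K 0 ∧ IsIntegralSurgery (𝓡 3) Y K' 0 ∧ K.IsSmoothlySlice ∧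
          K'.HasRasmussenInvariant s ∧ s ≠ 0 ∧ K'.IsSmoothlySlice := by
  rintro ⟨K, K', Y, _, _, s, -, -, -, hs, hs0, hsl'⟩
  exact hs0 (hR hs hsl')

/-! ## §3 Position: what kills the crux -/

/-- **A positive answer to MMSW Question 9.11 (knots) kills the crux** — the weakest catalogued
statement doing so; OPEN in print. [cite: ManolescuMarengonSarkarWillis2023, Question 9.11] -/
theorem not_crux_of_mmsw911 (h : MMSW2023Question911Knot) : ¬ Crux :=
  not_crux_iff_sVanishesOnPairs.2 (sVanishesOnPairs_of_mmsw2023Question911Knot h)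

/-- **"The `0`-surgery type determines sliceness" kills the crux**, mod Rasmussen's Theorem 1 (the
hypothesis `hA` is the body of the route's kill switch `Assembly2`, item 0367, spelled out).
[cite: Rasmussen2010, Thm. 1] -/
theorem not_crux_of_zeroSurgeryDeterminesSliceness (hR : eq_zero_of_isSmoothlySlice)
    (hA : ∀ (K K' : Knot) (Y : Type) [TopologicalSpace Y] [ChartedSpace (EuclideanSpace ℝ (Fin 3)) Y],
      IsIntegralSurgery (𝓡 3) Y K 0 → IsIntegralSurgery (𝓡 3) Y K' 0 → K.IsSmoothlySlice →
        K'.IsSmoothlySlice) : ¬ Crux := by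
  rintro ⟨K, K', Y, _, _, s, hK, hK', hsl, hs, hs0⟩
  exact hs0 (hR hs (hA K K' Y hK hK' hsl))

/-- The route's kill switch `Assembly2` (item 0367) kills the crux, mod Rasmussen's Theorem 1.
[cite: Rasmussen2010, Thm. 1] -/
theorem not_crux_of_assembly2 (hR : eq_zero_of_isSmoothlySlice)
    (hA : Theses.ZeroSurgeryExotic.Assembly2) : ¬ Crux :=
  not_crux_of_zeroSurgeryDeterminesSliceness hR fun K K' Y _ _ ↦ hA K K' Y

/-- **`SmoothPoincare4` + Rasmussen's Theorem 1 ⇒ `¬ Crux`**: on a witness pair `K'` is slice in a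
homotopy 4-ball (Manolescu–Piccirillo Lemma 3.3, PROVED: `isHomotopyBallSlice_of_zeroSurgeryPair`), hence —
were it not smoothly slice — the FGMW lemma (PROVED: `Knot.exists_exotic_of_isHomotopyBallSlice_not_isSmoothlySlice_holds`)
would give a closed smooth `M ≃ₕ S⁴` with no diffeomorphism to `S⁴`, contradicting SPC4; so `K'` is slice
and `s(K') = 0`. A disproof of the crux is thus no harder than SPC4, and the crux is a genuine disproof
programme for SPC4 (the `SVanishesOnPairs`-side form is `ZseSVanishesOnPairs.Negative.sVanishesOnPairs_of_spc4`).
[cite: ManolescuPiccirillo2023, §1 p. 1] [cite: FreedmanGompfMorrisonWalker2010, §1] -/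
theorem not_crux_of_spc4 (hR : eq_zero_of_isSmoothlySlice) (hS : _root_.SmoothPoincare4) : ¬ Crux :=
  not_crux_of_zeroSurgeryDeterminesSliceness hR fun _ K' _ _ _ hK hK' hsl ↦ by
    by_contra hns
    obtain ⟨M, _, _, _, i₄, i₅, _, ⟨e⟩, hE⟩ :=
      Knot.exists_exotic_of_isHomotopyBallSlice_not_isSmoothlySlice_holds
        ⟨K', isHomotopyBallSlice_of_zeroSurgeryPair hK hK' hsl, hns⟩
    obtain ⟨d⟩ := hS M i₄ i₅ e
    exact hE.false d

/-! ## §4 Barrier sub-family: the partner bounds no disc in a punctured Gluck twist (MMSW Cor. 1.13) -/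

/-- Mod MMSW Cor. 1.13 (tree named fact `rasmussen_eq_zero_of_isSliceDiscIn_gluckTwist`): a knot `K'` with
`s(K') ≠ 0` bounds NO smooth proper disc in the punctured Gluck twist of any 2-knot; so the
Manolescu–Piccirillo homotopy sphere of a witness is never a Gluck twist — witnesses must come from
`0`-surgery homeomorphisms whose sphere is not of this form. [cite: ManolescuMarengonSarkarWillis2023, Cor. 1.13] -/
theorem crux_witness_avoids_gluckTwist (h113 : rasmussen_eq_zero_of_isSliceDiscIn_gluckTwist)
    {K' : Knot} {s : ℤ} (hs : K'.HasRasmussenInvariant s) (hs0 : s ≠ 0) (K₂ : TwoKnot)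
    (X : Type) [TopologicalSpace X] [T2Space X] [SecondCountableTopology X]
    [ChartedSpace (EuclideanSpace ℝ (Fin 4)) X] [IsManifold (𝓡 4) ∞ X] (hX : IsGluckTwist (𝓡 4) X K₂)
    (e : EuclideanSpace ℝ (Fin 4) → X) (f : EuclideanSpace ℝ (Fin 2) → X) :
    ¬ K'.IsSliceDiscIn X e f :=
  fun hK ↦ hs0 (h113 K₂ X hX K' e f hK s hs)

end Summit.SmoothPoincare4.SmoothPoincare4.Theorems.ZseCruxRasmussen.Negative

end
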